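import Summits.CriticalPhenomena.PercolationContinuityZ3.Theorems.PercNearOneGluingNoHeavyLowerTailE3FourPointSplitCells
import HarnessLib

/-!
# `NoHeavyLowerTail` (crux stmt-CriticalPhenomena-4575): Sahi's `E₃` of the E3GRP four-point class `γ` (the three 2|2-split LINK
# events) is the `Q`-weighted sunflower cubic `(1+Q)·(R·Q − e₂(x)) − e₃(x)` — twin of the perfect-matching triple `F₄`;
# `γ ≥ −e₃` on every graph, and four-point `AG⁺` implies both `γ ≥ 0` and `F₄ ≥ 0`

Support file (certificate seat `prim-cert-2` gen 9; `--supports stmt-CriticalPhenomena-4575`).  No definitions, no named facts, no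
sorries.  Cells as in `…E3FourPointSplitCells` / `Literature…prodBernoulli_sahiE3_fourPointMatching_eq`: for vertices `a, b, c, y`
of a finite weighted graph (`μ = prodBernoulli w`), `T` = some three of the four mutually joined, `R = μ(T)`, `U₁ = {a↔b}∪{c↔y}`,
`U₂ = {a↔c}∪{b↔y}`, `U₃ = {a↔y}∪{b↔c}`, `Q = μ((U₁∪U₂∪U₃)ᶜ)` (all four separated), `x_k = μ(U_k ∖ T)`; `Q + R + x₁ + x₂ + x₃ = 1`.

* `prodBernoulli_sahiE3_fourPointSplit_eq` — **`γ := E₃(U[ab|cy], U[ac|by], U[ay|bc]) = (1 + Q)·(R·Q − (x₁x₂+x₁x₃+x₂x₃)) − x₁x₂x₃`**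
  (exact, every law of this shape: `Literature…sahiE3_compl_sunflower_eq` applied to the split sunflower with core `Q₄`).  The
  Literature file has the companion `E₃(U₁ᶜ,U₂ᶜ,U₃ᶜ) = (1 + R)(R·Q − e₂(x)) − e₃(x)` (=: `F₄`, the "(1+R)AG₄ − e₃" row): `γ` and `F₄`
  are the two sunflower-complement cubics on the same five cells (`γ` = the `Q`-weighted twin, as `Fd = (1+q)AG − e₃` is the twin
  of `F = (1+t)AG − e₃ = 3PT-LB` at three points).
* `prodBernoulli_sahiE3_fourPointSplit_ge` — `γ ≥ −x₁x₂x₃` on EVERY finite weighted graph (Gladkov's strong Harris–Kleitman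
  `R·Q ≥ e₂(x)`, tree `prodBernoulli_strongHarris_sunflower_three`).
* `sahiE3_fourPoint_nonneg_of_agPlus` — the single cubic inequality `e₂(x) + e₃(x) ≤ R·Q` (four-point `AG⁺` = `G₄ ≥ 0`; three-copy
  fibrewise positive on `K≤6`, prim-cert-2 gen 5 / ttrl2; an instance of 'lattice `AG⁺`', cf. `SunflowerCubic.core_bernstein`; OPEN)
  implies BOTH `γ ≥ 0` and `F₄ ≥ 0`.
Context: `γ` is one of the five four-point E3GRP classes (`(iii), (b), α, β, γ` of `…E3FourPointClassesLeFive`) not yet proved on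
general graphs; this places `γ` (alone among the five: the others are not equal-intersection sunflowers) in the lattice-`AG⁺`/`SHK3⁺`
sunflower family attacked by one-coordinate induction (`…SunflowerCubicInduction*`).  Memo: prim-cert-2/FINDING-K6-THREECOPY-KERNEL-COST.md.
-/

noncomputable section

namespace Summit.CriticalPhenomena.PercolationContinuityZ3.Theorems

open MeasureTheory Set
open Literature.Probability.Percolation Literature.Probability.LatticeModels

namespace FourPointSplit

variable {V : Type*}

variable [Finite V]

/-- **Sahi's `E₃` on the three 2|2-split LINK events of four vertices (E3GRP class `γ`) is the `Q`-weighted sunflower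
cubic.**  For `μ = prodBernoulli w` and vertices `a, b, c, y`, with the cells of
`Literature…prodBernoulli_sahiE3_fourPointMatching_eq` — `T` = some three of the four mutually joined, `R = μ(T)`,
`U₁ = {a↔b} ∪ {c↔y}`, `U₂ = {a↔c} ∪ {b↔y}`, `U₃ = {a↔y} ∪ {b↔c}` (the three perfect matchings), `Q = μ((U₁ ∪ U₂ ∪ U₃)ᶜ)` (all four
pairwise separated), `x_k = μ(U_k ∖ T)`:
`E₃(U[ab|cy], U[ac|by], U[ay|bc]) = (1 + Q)·(R·Q − (x₁x₂ + x₁x₃ + x₂x₃)) − x₁x₂x₃`,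
where `U[ab|cy] = {a↔c} ∪ {a↔y} ∪ {b↔c} ∪ {b↔y}` etc.  Compare `E₃(U₁ᶜ, U₂ᶜ, U₃ᶜ) = (1 + R)(R·Q − e₂(x)) − e₃(x)` (`F₄`, same file):
`γ` and `F₄` are the two sunflower-complement cubics on the same five cells. [this work] -/
theorem prodBernoulli_sahiE3_fourPointSplit_eq (w : Sym2 V → unitInterval) (a b c y : V) :
    sahiE3 (prodBernoulli w) (openConn a c ∪ openConn a y ∪ openConn b c ∪ openConn b y)
        (openConn a b ∪ openConn a y ∪ openConn b c ∪ openConn c y) (openConn a b ∪ openConn a c ∪ openConn b y ∪ openConn c y) =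
      (1 + (prodBernoulli w).real
            ((openConn a b ∪ openConn c y) ∪ (openConn a c ∪ openConn b y) ∪ (openConn a y ∪ openConn b c))ᶜ) *
          ((prodBernoulli w).real
                (openConn a b ∩ openConn a c ∪ openConn a b ∩ openConn a y ∪ openConn a c ∩ openConn a y ∪
                  openConn b c ∩ openConn b y) *
              (prodBernoulli w).real
                ((openConn a b ∪ openConn c y) ∪ (openConn a c ∪ openConn b y) ∪ (openConn a y ∪ openConn b c))ᶜ -
            ((prodBernoulli w).real
                  ((openConn a b ∪ openConn c y) \
                    (openConn a b ∩ openConn a c ∪ openConn a b ∩ openConn a y ∪ openConn a c ∩ openConn a y ∪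
                      openConn b c ∩ openConn b y)) *
                (prodBernoulli w).real
                  ((openConn a c ∪ openConn b y) \
                    (openConn a b ∩ openConn a c ∪ openConn a b ∩ openConn a y ∪ openConn a c ∩ openConn a y ∪
                      openConn b c ∩ openConn b y)) +
              (prodBernoulli w).real
                  ((openConn a b ∪ openConn c y) \
                    (openConn a b ∩ openConn a c ∪ openConn a b ∩ openConn a y ∪ openConn a c ∩ openConn a y ∪
                      openConn b c ∩ openConn b y)) *
                (prodBernoulli w).real
                  ((openConn a y ∪ openConn b c) \
                    (openConn a b ∩ openConn a c ∪ openConn a b ∩ openConn a y ∪ openConn a c ∩ openConn a y ∪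
                      openConn b c ∩ openConn b y)) +
              (prodBernoulli w).real
                  ((openConn a c ∪ openConn b y) \
                    (openConn a b ∩ openConn a c ∪ openConn a b ∩ openConn a y ∪ openConn a c ∩ openConn a y ∪
                      openConn b c ∩ openConn b y)) *
                (prodBernoulli w).real
                  ((openConn a y ∪ openConn b c) \
                    (openConn a b ∩ openConn a c ∪ openConn a b ∩ openConn a y ∪ openConn a c ∩ openConn a y ∪
                      openConn b c ∩ openConn b y)))) -
        (prodBernoulli w).real
              ((openConn a b ∪ openConn c y) \
                (openConn a b ∩ openConn a c ∪ openConn a b ∩ openConn a y ∪ openConn a c ∩ openConn a y ∪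
                  openConn b c ∩ openConn b y)) *
            (prodBernoulli w).real
              ((openConn a c ∪ openConn b y) \
                (openConn a b ∩ openConn a c ∪ openConn a b ∩ openConn a y ∪ openConn a c ∩ openConn a y ∪
                  openConn b c ∩ openConn b y)) *
          (prodBernoulli w).real
            ((openConn a y ∪ openConn b c) \
              (openConn a b ∩ openConn a c ∪ openConn a b ∩ openConn a y ∪ openConn a c ∩ openConn a y ∪
                openConn b c ∩ openConn b y)) := by
  classical
  have h₁ : MeasurableSet ((openConn a c)ᶜ ∩ (openConn a y)ᶜ ∩ (openConn b c)ᶜ ∩ (openConn b y)ᶜ : Set (BondConfig V)) :=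
    MeasurableSet.of_discrete
  have h₂ : MeasurableSet ((openConn a b)ᶜ ∩ (openConn a y)ᶜ ∩ (openConn b c)ᶜ ∩ (openConn c y)ᶜ : Set (BondConfig V)) :=
    MeasurableSet.of_discrete
  have h₃ : MeasurableSet ((openConn a b)ᶜ ∩ (openConn a c)ᶜ ∩ (openConn b y)ᶜ ∩ (openConn c y)ᶜ : Set (BondConfig V)) :=
    MeasurableSet.of_discrete
  rw [union₄_eq_compl_inter₄ (openConn a c), union₄_eq_compl_inter₄ (openConn a b), union₄_eq_compl_inter₄ (openConn a b),
    sahiE3_compl_sunflower_eq (prodBernoulli w) h₁ h₂ h₃ (split_inter₁₂ a b c y) (split_inter₁₃ a b c y)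
      (split_inter₂₃ a b c y),
    split_sdiff_eq_petal₁, split_sdiff_eq_petal₂, split_sdiff_eq_petal₃, split_union_compl_eq_core, split_core_eq_compl_union]
  ring

/-- **Class `γ ≥ −e₃` on every finite weighted graph**: with the cells above,
`E₃(U[ab|cy], U[ac|by], U[ay|bc]) ≥ −x₁x₂x₃` — from the identity and Gladkov's strong Harris–Kleitman inequality
`R·Q ≥ x₁x₂ + x₁x₃ + x₂x₃` for the perfect-matching sunflower (tree `prodBernoulli_strongHarris_sunflower_three`). [this work] -/
theorem prodBernoulli_sahiE3_fourPointSplit_ge (w : Sym2 V → unitInterval) (a b c y : V) :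
    -((prodBernoulli w).real
              ((openConn a b ∪ openConn c y) \
                (openConn a b ∩ openConn a c ∪ openConn a b ∩ openConn a y ∪ openConn a c ∩ openConn a y ∪
                  openConn b c ∩ openConn b y)) *
            (prodBernoulli w).real
              ((openConn a c ∪ openConn b y) \
                (openConn a b ∩ openConn a c ∪ openConn a b ∩ openConn a y ∪ openConn a c ∩ openConn a y ∪
                  openConn b c ∩ openConn b y)) *
          (prodBernoulli w).real
            ((openConn a y ∪ openConn b c) \
              (openConn a b ∩ openConn a c ∪ openConn a b ∩ openConn a y ∪ openConn a c ∩ openConn a y ∪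
                openConn b c ∩ openConn b y))) ≤
      sahiE3 (prodBernoulli w) (openConn a c ∪ openConn a y ∪ openConn b c ∪ openConn b y)
        (openConn a b ∪ openConn a y ∪ openConn b c ∪ openConn c y) (openConn a b ∪ openConn a c ∪ openConn b y ∪ openConn c y) := by
  rw [prodBernoulli_sahiE3_fourPointSplit_eq]
  have hAG := prodBernoulli_strongHarris_sunflower_three w
    ((isUpperSet_openConn a b).union (isUpperSet_openConn c y))
    ((isUpperSet_openConn a c).union (isUpperSet_openConn b y))
    ((isUpperSet_openConn a y).union (isUpperSet_openConn b c))
    (openConn_matching_inter₁₂ a b c y) (openConn_matching_inter₁₃ a b c y) (openConn_matching_inter₂₃ a b c y)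
  have hQ : 0 ≤ (prodBernoulli w).real
      ((openConn a b ∪ openConn c y) ∪ (openConn a c ∪ openConn b y) ∪ (openConn a y ∪ openConn b c))ᶜ := measureReal_nonneg
  have h1 : 0 ≤ 1 + (prodBernoulli w).real
      ((openConn a b ∪ openConn c y) ∪ (openConn a c ∪ openConn b y) ∪ (openConn a y ∪ openConn b c))ᶜ := by linarith
  nlinarith [mul_nonneg h1 (sub_nonneg.2 hAG)]

/-- **Four-point `AG⁺` closes both sunflower cubics.**  If, for the cells above, `x₁x₂ + x₁x₃ + x₂x₃ + x₁x₂x₃ ≤ R·Q` (the cubic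
strengthening `G₄ ≥ 0` of Gladkov's `AG₄ = R·Q − e₂(x) ≥ 0`; fibrewise positive on `K≤6`, open in general — an instance of
'lattice `AG⁺`', cf. `SunflowerCubic.core_bernstein`), then BOTH `γ = E₃(U[ab|cy], U[ac|by], U[ay|bc]) ≥ 0` and
`F₄ = E₃({a↮b}∩{c↮y}, {a↮c}∩{b↮y}, {a↮y}∩{b↮c}) ≥ 0`. [this work] -/
theorem sahiE3_fourPoint_nonneg_of_agPlus (w : Sym2 V → unitInterval) (a b c y : V)
    (hG4 : (prodBernoulli w).real
              ((openConn a b ∪ openConn c y) \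
                (openConn a b ∩ openConn a c ∪ openConn a b ∩ openConn a y ∪ openConn a c ∩ openConn a y ∪
                  openConn b c ∩ openConn b y)) *
            (prodBernoulli w).real
              ((openConn a c ∪ openConn b y) \
                (openConn a b ∩ openConn a c ∪ openConn a b ∩ openConn a y ∪ openConn a c ∩ openConn a y ∪
                  openConn b c ∩ openConn b y)) +
          (prodBernoulli w).real
              ((openConn a b ∪ openConn c y) \
                (openConn a b ∩ openConn a c ∪ openConn a b ∩ openConn a y ∪ openConn a c ∩ openConn a y ∪
                  openConn b c ∩ openConn b y)) *
            (prodBernoulli w).real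
              ((openConn a y ∪ openConn b c) \
                (openConn a b ∩ openConn a c ∪ openConn a b ∩ openConn a y ∪ openConn a c ∩ openConn a y ∪
                  openConn b c ∩ openConn b y)) +
          (prodBernoulli w).real
              ((openConn a c ∪ openConn b y) \
                (openConn a b ∩ openConn a c ∪ openConn a b ∩ openConn a y ∪ openConn a c ∩ openConn a y ∪
                  openConn b c ∩ openConn b y)) *
            (prodBernoulli w).real
              ((openConn a y ∪ openConn b c) \
                (openConn a b ∩ openConn a c ∪ openConn a b ∩ openConn a y ∪ openConn a c ∩ openConn a y ∪
                  openConn b c ∩ openConn b y)) +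
          (prodBernoulli w).real
              ((openConn a b ∪ openConn c y) \
                (openConn a b ∩ openConn a c ∪ openConn a b ∩ openConn a y ∪ openConn a c ∩ openConn a y ∪
                  openConn b c ∩ openConn b y)) *
            (prodBernoulli w).real
              ((openConn a c ∪ openConn b y) \
                (openConn a b ∩ openConn a c ∪ openConn a b ∩ openConn a y ∪ openConn a c ∩ openConn a y ∪
                  openConn b c ∩ openConn b y)) *
            (prodBernoulli w).real
              ((openConn a y ∪ openConn b c) \
                (openConn a b ∩ openConn a c ∪ openConn a b ∩ openConn a y ∪ openConn a c ∩ openConn a y ∪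
                  openConn b c ∩ openConn b y)) ≤
        (prodBernoulli w).real
            (openConn a b ∩ openConn a c ∪ openConn a b ∩ openConn a y ∪ openConn a c ∩ openConn a y ∪
              openConn b c ∩ openConn b y) *
          (prodBernoulli w).real
            ((openConn a b ∪ openConn c y) ∪ (openConn a c ∪ openConn b y) ∪ (openConn a y ∪ openConn b c))ᶜ) :
    0 ≤ sahiE3 (prodBernoulli w) (openConn a c ∪ openConn a y ∪ openConn b c ∪ openConn b y)
        (openConn a b ∪ openConn a y ∪ openConn b c ∪ openConn c y) (openConn a b ∪ openConn a c ∪ openConn b y ∪ openConn c y) ∧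
      0 ≤ sahiE3 (prodBernoulli w) ((openConn a b)ᶜ ∩ (openConn c y)ᶜ) ((openConn a c)ᶜ ∩ (openConn b y)ᶜ)
        ((openConn a y)ᶜ ∩ (openConn b c)ᶜ) := by
  have hQ : 0 ≤ (prodBernoulli w).real
      ((openConn a b ∪ openConn c y) ∪ (openConn a c ∪ openConn b y) ∪ (openConn a y ∪ openConn b c))ᶜ := measureReal_nonneg
  have hR : 0 ≤ (prodBernoulli w).real
      (openConn a b ∩ openConn a c ∪ openConn a b ∩ openConn a y ∪ openConn a c ∩ openConn a y ∪
        openConn b c ∩ openConn b y : Set (BondConfig V)) := measureReal_nonneg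
  have hx₁ : 0 ≤ (prodBernoulli w).real ((openConn a b ∪ openConn c y) \
      (openConn a b ∩ openConn a c ∪ openConn a b ∩ openConn a y ∪ openConn a c ∩ openConn a y ∪
        openConn b c ∩ openConn b y)) := measureReal_nonneg
  have hx₂ : 0 ≤ (prodBernoulli w).real ((openConn a c ∪ openConn b y) \
      (openConn a b ∩ openConn a c ∪ openConn a b ∩ openConn a y ∪ openConn a c ∩ openConn a y ∪
        openConn b c ∩ openConn b y)) := measureReal_nonneg
  have hx₃ : 0 ≤ (prodBernoulli w).real ((openConn a y ∪ openConn b c) \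
      (openConn a b ∩ openConn a c ∪ openConn a b ∩ openConn a y ∪ openConn a c ∩ openConn a y ∪
        openConn b c ∩ openConn b y)) := measureReal_nonneg
  have he₃ := mul_nonneg (mul_nonneg hx₁ hx₂) hx₃
  constructor
  · rw [prodBernoulli_sahiE3_fourPointSplit_eq]
    nlinarith [mul_nonneg hQ he₃, mul_nonneg hQ (mul_nonneg hx₁ hx₂), mul_nonneg hQ (mul_nonneg hx₁ hx₃),
      mul_nonneg hQ (mul_nonneg hx₂ hx₃)]
  · rw [prodBernoulli_sahiE3_fourPointMatching_eq]
    nlinarith [mul_nonneg hR he₃, mul_nonneg hR (mul_nonneg hx₁ hx₂), mul_nonneg hR (mul_nonneg hx₁ hx₃),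
      mul_nonneg hR (mul_nonneg hx₂ hx₃)]

end FourPointSplit

end Summit.CriticalPhenomena.PercolationContinuityZ3.Theorems

end
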